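import Literature.NumberTheory.Automorphic.Liu2021.AppendixC.OmegaHomBettiComparisonRank
import HarnessLib

/-!
# [Liu 2021, §4.2 / §D.4] Γ_E acts by SCALARS on the block of values of a rank-`≤ 1` Hom-space
# `Hom_{ℚ_ℓ^{ac}[𝔾]}(ι_ℓ ∘ ω, ℚ_ℓ^{ac} ⊗ H¹_ét(A_∞))`

Topic `NumberTheory/Automorphic/Liu2021/AppendixC`; namespace `Literature.NumberTheory.Automorphic.Liu2021.AppendixC`.
THEOREMS ONLY (no `def`, no named fact, no instance, no `sorry`).  Cell `hodgecm-mathlib`, crux `HLiu418` =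
stmt-HodgeConjecture-24832, d6 line ([Liu2021] Thm. D.6 (1), one CM curve), HOME card `A-plan/d6/D6-LINE-CARD.A-plan2g11.md`
v3.4 §0′ (a): this file is the ADAPTOR «S1 clause (1) (multiplicity one: the Hom-space `Homs = X.omegaHom ι ρW` is at most
one-dimensional) ⟹ SocketS1 / GS1 (`Γ_E` acts on the block `{f w | f ∈ Homs, w ∈ W}` by a scalar function `m : Γ_E → ℚ_ℓ^{ac}`)»
(A-plan2 (g11) word 2026-08-29T20:45:39Z).  The conclusion of every theorem below is the body of the probe's `GS1`
(`D6GlueProbeA-generic.A-p15g10.lean`) TOKEN FOR TOKEN: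

  `∃ m : Field.absoluteGaloisGroup E → AlgebraicClosure ℚ_[ℓ], ∀ σ : Field.absoluteGaloisGroup E, ∀ f ∈ X.omegaHom ι ρW, ∀ w : W,`
  `  (C.towerRep ℓ σ).baseChange (AlgebraicClosure ℚ_[ℓ]) (f w) = m σ • f w`

so that next run `SocketS1 := exists_towerRep_baseChange_apply_eq_smul_of_… (the registered S1 clause (1))` is one line.

PRINT ([Liu2021] = Y. Liu, *Fourier–Jacobi cycles and arithmetic relative trace formula*, Camb. J. Math. **9** (2021), `FJcycle.tex`):
§4.2 l. 2160–2168 «Then `Hom_{ℚ_ℓ^{ac}[𝔾(𝔸_F^∞)]}(ι_ℓ ∘ ω(μ,ε,χ), H¹_ét(A_∞ ⊗_{E,τ'} ℂ, ℚ_ℓ^{ac}))` is a representation of `Gal(ℂ/τ'(E))`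
over `ℚ_ℓ^{ac}`. By Proposition 4.13, such representation is an `ℓ`-adic character, which we denote by `ρ_{τ',ι_ℓ}(μ,ε,χ)`»;
§D.4 l. 5620–5624 (proof of Thm. D.6 (1)): the same sentence for the curve, with [Liu2021, Prop. D.4 (1)] (l. 5376–5383; multiplicity one,
Rem. D.5 l. 5396–5405) in place of Prop. 4.13.  The mathematics is linear algebra: `Γ_E` preserves `Homs` (★ `towerRep_comp_mem_omegaHom`,
because the Hecke action commutes with `Γ_E`), and an endomorphism of a line is a scalar; the scalar at `σ` then multiplies
every value `f w`.

CONTENT (all of `C`, `ℓ`, `X`, `ι`, `(W, ρW)` arbitrary):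
* `exists_towerRep_baseChange_apply_eq_smul_of_le_span_singleton` — CORE: if `Homs ≤ ℚ_ℓ^{ac} · f₀` for some `f₀ ∈ Homs`
  (possibly `0`), then GS1;
* `…_of_rank_omegaHom_le_one` / `…_of_finrank_omegaHom_le_one` — GS1 from `Module.rank _ Homs ≤ 1` / `Module.finrank _ Homs ≤ 1`
  (the v15/v22 registry currency of `a3_liu418`, cf. ★ `exists_eq_smul_of_rank_omegaHom_le_one`);
* `…_of_mult1Line` — GS1 from the LINE FORM «`∀ f g ∈ Homs, f ≠ 0 → ∃ b, g = b • f`» (★ `BettiComparison.mult1Line_of_rank_le_one`);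
* `…_of_pairwise` — GS1 from the card's S1 Lean shape «any two members are proportional: `∃ c, g = c • f ∨ f = c • g`»;
* `BettiComparison.exists_towerRep_baseChange_apply_eq_smul_of_rank_intertwiningMap_le_one` — GS1 from the BETTI multiplicity
  bound `Module.rank ℂ Hom_{ℂ[𝔾]}(ω, H¹_{B,τ'}) ≤ 1` (floor row III-J3a / [Liu2021, Prop. D.4 (1)] currency) through a comparison
  `B : C.BettiComparison ℓ X H rhoB ι` (★ `rank_omegaHom_le_one`).
HC_CM is proved only modulo the 7 printed citations until rung 0 closes; this file discharges none of them and moves no book.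

## References
* [Liu2021] Y. Liu, Camb. J. Math. **9** (2021) 1–147 = arXiv:2102.11518: §4.2 (`FJcycle.tex` l. 2160–2168), Prop. 4.13
  (l. 2113–2147), App. D Prop. D.4 (1) (l. 5376–5383) and Rem. D.5 (l. 5396–5405), proof of Thm. D.6 (1) (l. 5620–5624).
* Tree: ★ `Sec42Data.EtaleHeckeDatum.omegaHom` / `towerRep_comp_mem_omegaHom` (`AppendixC/Thm415Pinned.lean`),
  ★ `exists_eq_smul_of_rank_omegaHom_le_one`, ★ `BettiComparison.rank_omegaHom_le_one` (`AppendixC/OmegaHomBettiComparisonRank.lean`).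
-/

noncomputable section

open NumberField
open scoped TensorProduct

namespace Literature.NumberTheory.Automorphic.Liu2021.AppendixC

variable {F E : Type} [Field F] [NumberField F] [IsTotallyReal F] [Field E] [NumberField E] [Algebra F E]
  [IsTotallyComplex E] [Algebra.IsQuadraticExtension F E]
variable {P5 : PropC5Data F E} {isotropicAt : ℕ → Prop}

namespace Sec42Data

variable {C : Sec42Data P5 isotropicAt} {ℓ : ℕ} [Fact ℓ.Prime] (X : C.EtaleHeckeDatum ℓ)
  (ι : ℂ ≃+* AlgebraicClosure ℚ_[ℓ]) {W : Type} [AddCommGroup W] [Module ℂ W] (ρW : Representation ℂ C.G W)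

namespace EtaleHeckeDatum

/-- **CORE.**  If the Hom-space `Homs = Hom_{ℚ_ℓ^{ac}[𝔾]}(ι_ℓ ∘ ω, ℚ_ℓ^{ac} ⊗ H¹_ét(A_∞))` lies in the line spanned by ONE of its
members `f₀` (possibly `0`), then `Γ_E` acts on every value `f w` (`f ∈ Homs`, `w ∈ W`) by a scalar `m σ` INDEPENDENT of `f`
and `w`: `σ ∘ f₀ ∈ Homs` (★ `towerRep_comp_mem_omegaHom`) is `m σ • f₀`, and every `f` is a multiple of `f₀`.
[cite: Liu2021, §4.2 (FJcycle.tex l. 2160–2168); proof of Thm. D.6 (1) (l. 5620–5624)] -/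
theorem exists_towerRep_baseChange_apply_eq_smul_of_le_span_singleton
    {f₀ : W →ₛₗ[(ι : ℂ →+* AlgebraicClosure ℚ_[ℓ])] AlgebraicClosure ℚ_[ℓ] ⊗[ℚ_[ℓ]] C.etaleH1Tower ℓ}
    (hf₀ : f₀ ∈ X.omegaHom ι ρW)
    (hline : ∀ g ∈ X.omegaHom ι ρW, ∃ b : AlgebraicClosure ℚ_[ℓ], g = b • f₀) :
    ∃ m : Field.absoluteGaloisGroup E → AlgebraicClosure ℚ_[ℓ],
      ∀ σ : Field.absoluteGaloisGroup E, ∀ f ∈ X.omegaHom ι ρW, ∀ w : W,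
        (C.towerRep ℓ σ).baseChange (AlgebraicClosure ℚ_[ℓ]) (f w) = m σ • f w := by
  classical
  have key : ∀ σ : Field.absoluteGaloisGroup E, ∃ b : AlgebraicClosure ℚ_[ℓ],
      ((C.towerRep ℓ σ).baseChange (AlgebraicClosure ℚ_[ℓ])).comp f₀ = b • f₀ :=
    fun σ => hline _ (X.towerRep_comp_mem_omegaHom ι ρW hf₀ σ)
  choose m hm using key
  refine ⟨m, fun σ f hf w => ?_⟩
  obtain ⟨b, rfl⟩ := hline f hf
  have h0 : (C.towerRep ℓ σ).baseChange (AlgebraicClosure ℚ_[ℓ]) (f₀ w) = m σ • f₀ w := by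
    simpa only [LinearMap.comp_apply, LinearMap.smul_apply] using LinearMap.congr_fun (hm σ) w
  rw [LinearMap.smul_apply, map_smul, h0, smul_comm]

/-- **GS1 from `rank ≤ 1`.**  If `Module.rank ℚ_ℓ^{ac} Homs ≤ 1` («such representation is an `ℓ`-adic character», l. 2166–2168),
`Γ_E` acts on the block of values `{f w}` by scalars.  (The `Module.Free` instance on the subspace is supplied by hand, as in
★ `exists_eq_smul_of_rank_omegaHom_le_one`.) [cite: Liu2021, §4.2 (FJcycle.tex l. 2160–2168); proof of Thm. D.6 (1) (l. 5620–5624)] -/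
theorem exists_towerRep_baseChange_apply_eq_smul_of_rank_omegaHom_le_one
    (h : Module.rank (AlgebraicClosure ℚ_[ℓ]) (X.omegaHom ι ρW) ≤ 1) :
    ∃ m : Field.absoluteGaloisGroup E → AlgebraicClosure ℚ_[ℓ],
      ∀ σ : Field.absoluteGaloisGroup E, ∀ f ∈ X.omegaHom ι ρW, ∀ w : W,
        (C.towerRep ℓ σ).baseChange (AlgebraicClosure ℚ_[ℓ]) (f w) = m σ • f w := by
  haveI : Module.Free (AlgebraicClosure ℚ_[ℓ]) (X.omegaHom ι ρW) :=
    @Module.Free.of_divisionRing _ _ _ (Submodule.addCommGroup _) _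
  obtain ⟨f₀, hf₀, hle⟩ := (rank_submodule_le_one_iff _).mp h
  refine X.exists_towerRep_baseChange_apply_eq_smul_of_le_span_singleton ι ρW hf₀ fun g hg => ?_
  obtain ⟨b, hb⟩ := Submodule.mem_span_singleton.mp (hle hg)
  exact ⟨b, hb.symm⟩

/-- **GS1 from `finrank ≤ 1`** (the v15 registry currency `Module.finrank _ (X.omegaHom ι ρ) ≤ 1` with `Module.Finite`).
[cite: Liu2021, §4.2 (FJcycle.tex l. 2160–2168); proof of Thm. D.6 (1) (l. 5620–5624)] -/
theorem exists_towerRep_baseChange_apply_eq_smul_of_finrank_omegaHom_le_one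
    [Module.Finite (AlgebraicClosure ℚ_[ℓ]) (X.omegaHom ι ρW)]
    (h : Module.finrank (AlgebraicClosure ℚ_[ℓ]) (X.omegaHom ι ρW) ≤ 1) :
    ∃ m : Field.absoluteGaloisGroup E → AlgebraicClosure ℚ_[ℓ],
      ∀ σ : Field.absoluteGaloisGroup E, ∀ f ∈ X.omegaHom ι ρW, ∀ w : W,
        (C.towerRep ℓ σ).baseChange (AlgebraicClosure ℚ_[ℓ]) (f w) = m σ • f w := by
  haveI : Module.Free (AlgebraicClosure ℚ_[ℓ]) (X.omegaHom ι ρW) :=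
    @Module.Free.of_divisionRing _ _ _ (Submodule.addCommGroup _) _
  refine X.exists_towerRep_baseChange_apply_eq_smul_of_rank_omegaHom_le_one ι ρW ?_
  rw [← Module.finrank_eq_rank (AlgebraicClosure ℚ_[ℓ]) (X.omegaHom ι ρW)]
  exact_mod_cast h

/-- **GS1 from the LINE FORM of multiplicity one** «`∀ f ∈ Homs, ∀ g ∈ Homs, f ≠ 0 → ∃ b, g = b • f`» (the v15 registered node
`Mult1OmegaHom`, output of ★ `BettiComparison.mult1Line_of_rank_le_one`).  If `Homs = 0` any `m` works.
[cite: Liu2021, §4.2 (FJcycle.tex l. 2160–2168); proof of Thm. D.6 (1) (l. 5620–5624)] -/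
theorem exists_towerRep_baseChange_apply_eq_smul_of_mult1Line
    (h : ∀ f ∈ X.omegaHom ι ρW, ∀ g ∈ X.omegaHom ι ρW, f ≠ 0 → ∃ b : AlgebraicClosure ℚ_[ℓ], g = b • f) :
    ∃ m : Field.absoluteGaloisGroup E → AlgebraicClosure ℚ_[ℓ],
      ∀ σ : Field.absoluteGaloisGroup E, ∀ f ∈ X.omegaHom ι ρW, ∀ w : W,
        (C.towerRep ℓ σ).baseChange (AlgebraicClosure ℚ_[ℓ]) (f w) = m σ • f w := by
  by_cases h0 : ∃ f₀ ∈ X.omegaHom ι ρW, f₀ ≠ 0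
  · obtain ⟨f₀, hf₀, hne⟩ := h0
    exact X.exists_towerRep_baseChange_apply_eq_smul_of_le_span_singleton ι ρW hf₀
      fun g hg => h f₀ hf₀ g hg hne
  · push Not at h0
    refine X.exists_towerRep_baseChange_apply_eq_smul_of_le_span_singleton ι ρW (X.omegaHom ι ρW).zero_mem
      fun g hg => ⟨0, ?_⟩
    rw [h0 g hg, zero_smul]

/-- **GS1 from the card's S1 shape** «any two members of `Homs` are proportional: `∃ c, g = c • f ∨ f = c • g`»
(`D6-LINE-CARD` v3.4 §1 S1, Lean shape of [Liu2021, Prop. D.4 (1)] on the `ℓ`-adic Hom-space).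
[cite: Liu2021, App. D Prop. D.4 (1) (l. 5376–5383) and Rem. D.5 (l. 5396–5405); proof of Thm. D.6 (1) (l. 5620–5624)] -/
theorem exists_towerRep_baseChange_apply_eq_smul_of_pairwise
    (h : ∀ f ∈ X.omegaHom ι ρW, ∀ g ∈ X.omegaHom ι ρW, ∃ c : AlgebraicClosure ℚ_[ℓ], g = c • f ∨ f = c • g) :
    ∃ m : Field.absoluteGaloisGroup E → AlgebraicClosure ℚ_[ℓ],
      ∀ σ : Field.absoluteGaloisGroup E, ∀ f ∈ X.omegaHom ι ρW, ∀ w : W,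
        (C.towerRep ℓ σ).baseChange (AlgebraicClosure ℚ_[ℓ]) (f w) = m σ • f w := by
  refine X.exists_towerRep_baseChange_apply_eq_smul_of_mult1Line ι ρW fun f hf g hg hne => ?_
  obtain ⟨c, hc | hc⟩ := h f hf g hg
  · exact ⟨c, hc⟩
  · have hc0 : c ≠ 0 := by
      rintro rfl
      exact hne (by simpa using hc)
    refine ⟨c⁻¹, ?_⟩
    rw [hc, smul_smul, inv_mul_cancel₀ hc0, one_smul]

end EtaleHeckeDatum

namespace BettiComparison

variable {X} {ι}
variable {H : Type} [AddCommGroup H] [Module ℂ H] {rhoB : Representation ℂ C.G H}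

/-- **GS1 from the BETTI multiplicity bound** `Module.rank ℂ Hom_{ℂ[𝔾]}(ω, H¹_{B,τ'}(A_∞, ℂ)) ≤ 1` (floor row III-J3a currency
`Prop413Data.multiplicity_le_one_printed`; for the curve: [Liu2021, Prop. D.4 (1)]) through a `𝔾`-equivariant comparison
`B : C.BettiComparison ℓ X H rhoB ι` (★ `rank_omegaHom_le_one`): `Γ_E` acts on the block of values by scalars.
[cite: Liu2021, §4.2 (FJcycle.tex l. 2152–2168); Prop. 4.13 (l. 2145); proof of Thm. D.6 (1) (l. 5620–5624)] -/
theorem exists_towerRep_baseChange_apply_eq_smul_of_rank_intertwiningMap_le_one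
    (B : C.BettiComparison ℓ X H rhoB ι) (ρW : Representation ℂ C.G W)
    (h : Module.rank ℂ (Representation.IntertwiningMap ρW rhoB) ≤ 1) :
    ∃ m : Field.absoluteGaloisGroup E → AlgebraicClosure ℚ_[ℓ],
      ∀ σ : Field.absoluteGaloisGroup E, ∀ f ∈ X.omegaHom ι ρW, ∀ w : W,
        (C.towerRep ℓ σ).baseChange (AlgebraicClosure ℚ_[ℓ]) (f w) = m σ • f w :=
  X.exists_towerRep_baseChange_apply_eq_smul_of_rank_omegaHom_le_one ι ρW (B.rank_omegaHom_le_one ρW h)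

end BettiComparison

end Sec42Data

end Literature.NumberTheory.Automorphic.Liu2021.AppendixC
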